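import Literature.NumberTheory.Sieve.BombieriVinogradovMoebius
import Literature.NumberTheory.LFunctions.SiegelWalfiszLiouville
import Mathlib.NumberTheory.Harmonic.Bounds
import HarnessLib

/-!
# Vaughan's mean value theorem for the Liouville function twisted by primitive characters

Topic `Literature/NumberTheory/Sieve`; everything in this file is PROVED.  It ports the tree's mean value
theorem for the Möbius function with a coprimality condition,
`Literature.NumberTheory.Sieve.moebius_character_meanValue` / `BVMoebius.sum_mvTerm_le`
(`∑_{d ≤ k} (d/φ(d)) ∑*_{χ mod d} max_{N ≤ x} |∑_{n ≤ N, (n,r)=1} μ(n)χ(n)| ≤ 110000 τ(r)(x + x^{5/6}k + x^{1/2}k²) log⁴(xk)`),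
to the Liouville function through `λ = 𝟙_□ ⋆ μ`:

* `liouvilleCharSum r χ X = ∑_{n ≤ X, (n, r) = 1} λ(n) χ(n)`, and its decomposition over the squares
  `liouvilleCharSum_eq_sum_sq` (`= ∑_{s ≤ X} 𝟙_□(s) χ_r(s) · M_r(X/s, χ)`), `norm_liouvilleCharSum_le`;
* `Lsup r χ x = max_{N ≤ x} |∑_{n ≤ N, (n,r)=1} λ(n)χ(n)|`, `lmvTerm r x d = (d/φ(d)) ∑*_{χ mod d} Lsup r χ x`;
* **`sum_lmvTerm_le`**: for `r ≠ 0`, `k ≥ 1`, `x ≥ 2`,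
  `∑_{d ≤ k} lmvTerm r x d ≤ 330000 τ(r) (x + (x^{5/6} k + x^{1/2} k²)(1 + log x)) log⁴(xk)`
  (the squares `j² ≤ x` are summed with the Möbius theorem at the heights `x/j²`; `∑ 1/j² ≤ 2`, `∑_{j ≤ √x} 1/j ≤
  1 + log x`, and heights `x/j² < 2` are bounded trivially).

This is the large-conductor engine of the double-family Bombieri–Vinogradov bound for `λ` with small-conductor
kernels (crux `TypeI2Dilated` of route `Summits/Parity/GeneralizedHardyLittlewood/Theses/LiouvilleShiftedTables.lean`,
line `peel-to-drappeau`, stub `stub_mainTerms`).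

## References

* R. C. Vaughan, *An elementary method in prime number theory*, Acta Arith. 37 (1980), 111–115, Theorem 1 (the
  method, there for `ψ(y, χ)`). [Vaughan1980]
* H. Iwaniec, E. Kowalski, *Analytic Number Theory*, AMS 2004, Theorem 17.4. [IwaniecKowalski2004]
-/

noncomputable section

open Finset Real Complex

namespace Literature.NumberTheory.Sieve

namespace LiouvilleMV

open ArithmeticFunction VaughanMoebius BVMoebius
open scoped ArithmeticFunction.Moebius ArithmeticFunction.sigma Classical
open Literature.NumberTheory.LFunctions.SiegelWalfiszLiouville (liouville_eq_sum_antidiagonal)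

/-! ### The twisted Liouville sum and its decomposition over the squares -/

/-- `Λ_r(X, χ) = ∑_{n ≤ X, (n, r) = 1} λ(n) χ(n)`, the Liouville sum twisted by the character `χ mod q` read
modulo `qr` (`copChar`). [folklore] -/
def liouvilleCharSum (r : ℕ) {q : ℕ} (χ : DirichletCharacter ℂ q) (X : ℕ) : ℂ :=
  ∑ n ∈ Ioc 0 X, (liouville n : ℂ) * copChar r χ n

/-- `λ(n) χ_r(n) = ∑_{sm = n} 𝟙_□(s) χ_r(s) · μ(m) χ_r(m)` (`λ = 𝟙_□ ⋆ μ` and the complete multiplicativity of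
`χ_r`). [folklore] -/
theorem liouville_mul_copChar_eq_sum (r : ℕ) {q : ℕ} (χ : DirichletCharacter ℂ q) (n : ℕ) :
    (liouville n : ℂ) * copChar r χ n =
      ∑ x ∈ n.divisorsAntidiagonal,
        ((if IsSquare x.1 then copChar r χ x.1 else 0) * ((μ x.2 : ℂ) * copChar r χ x.2)) := by
  have h := liouville_eq_sum_antidiagonal n
  have h' : (liouville n : ℂ) = ∑ x ∈ n.divisorsAntidiagonal,
      (if IsSquare x.1 then (1 : ℂ) else 0) * (μ x.2 : ℂ) := by
    have := congrArg (fun t : ℝ => (t : ℂ)) h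
    rw [show ((liouville n : ℝ) : ℂ) = (liouville n : ℂ) by norm_cast] at this
    rw [this]
    push_cast
    refine sum_congr rfl fun x _ => ?_
    split_ifs <;> simp
  rw [h', sum_mul]
  refine sum_congr rfl fun x hx => ?_
  rw [Nat.mem_divisorsAntidiagonal] at hx
  rw [← hx.1, copChar_mul]
  split_ifs <;> ring

/-- **`Λ_r(X, χ) = ∑_{s ≤ X} 𝟙_□(s) χ_r(s) M_r(X/s, χ)`.** [folklore] -/
theorem liouvilleCharSum_eq_sum_sq (r : ℕ) {q : ℕ} (χ : DirichletCharacter ℂ q) (X : ℕ) :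
    liouvilleCharSum r χ X =
      ∑ s ∈ Ioc 0 X, (if IsSquare s then copChar r χ s else 0) * moebiusCharSum r χ (X / s) := by
  unfold liouvilleCharSum
  rw [sum_congr rfl fun n _ => liouville_mul_copChar_eq_sum r χ n]
  rw [Vaughan.sum_Ioc_sum_divisorsAntidiagonal_eq
    (fun s m => (if IsSquare s then copChar r χ s else 0) * ((μ m : ℂ) * copChar r χ m)) X]
  refine sum_congr rfl fun s _ => ?_
  rw [moebiusCharSum, mul_sum]

/-- `|Λ_r(X, χ)| ≤ ∑_{s ≤ X, s = □} |M_r(X/s, χ)|`. [folklore] -/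
theorem norm_liouvilleCharSum_le (r : ℕ) {q : ℕ} (χ : DirichletCharacter ℂ q) (X : ℕ) :
    ‖liouvilleCharSum r χ X‖ ≤ ∑ s ∈ (Ioc 0 X).filter IsSquare, ‖moebiusCharSum r χ (X / s)‖ := by
  rw [liouvilleCharSum_eq_sum_sq, sum_filter]
  refine (norm_sum_le _ _).trans (sum_le_sum fun s _ => ?_)
  split_ifs with h
  · rw [norm_mul]
    exact mul_le_of_le_one_left (norm_nonneg _) (norm_copChar_le r χ s)
  · simp

/-- The trivial bound `|M_r(N, χ)| ≤ N`. [folklore] -/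
theorem norm_moebiusCharSum_le_self (r : ℕ) {q : ℕ} (χ : DirichletCharacter ℂ q) (N : ℕ) :
    ‖moebiusCharSum r χ N‖ ≤ N := by
  unfold moebiusCharSum
  refine (norm_sum_le _ _).trans ?_
  calc ∑ n ∈ Ioc 0 N, ‖(μ n : ℂ) * copChar r χ n‖ ≤ ∑ n ∈ Ioc 0 N, (1 : ℝ) :=
        sum_le_sum fun n _ => norm_moebius_mul_copChar_le r χ n
    _ = N := by simp

/-! ### The `N`-uniform majorant and the summed form -/

/-- `Λ*_r(x; χ) = max_{N ≤ x} |Λ_r(N, χ)|` (a `Finset.sup'` over `0 ≤ N ≤ ⌊x⌋`). [folklore] -/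
def Lsup (r : ℕ) {d : ℕ} (χ : DirichletCharacter ℂ d) (x : ℝ) : ℝ :=
  (range (⌊x⌋₊ + 1)).sup' ⟨0, by simp⟩ fun N : ℕ => ‖liouvilleCharSum r χ N‖

/-- `Λ*_r(x; χ) ≥ 0`. [folklore] -/
theorem Lsup_nonneg (r : ℕ) {d : ℕ} (χ : DirichletCharacter ℂ d) (x : ℝ) : 0 ≤ Lsup r χ x :=
  (norm_nonneg (liouvilleCharSum r χ 0)).trans
    (Finset.le_sup' (fun N : ℕ => ‖liouvilleCharSum r χ N‖) (by simp))

/-- `|Λ_r(N, χ)| ≤ Λ*_r(x; χ)` for `N ≤ x`. [folklore] -/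
theorem norm_liouvilleCharSum_le_Lsup (r : ℕ) {d : ℕ} (χ : DirichletCharacter ℂ d) {N : ℕ} {x : ℝ}
    (hN : (N : ℝ) ≤ x) : ‖liouvilleCharSum r χ N‖ ≤ Lsup r χ x := by
  refine Finset.le_sup' (fun N : ℕ => ‖liouvilleCharSum r χ N‖) ?_
  exact mem_range.2 (Nat.lt_succ_of_le (Nat.le_floor hN))

/-- **`Λ*_r(x; χ) ≤ ∑_{s ≤ x, s = □} M*_r(x/s; χ)`** (decomposition over the squares, at maximising heights).
[folklore] -/
theorem Lsup_le_sum_Msup (r : ℕ) {d : ℕ} (χ : DirichletCharacter ℂ d) {x : ℝ} (hx : 0 ≤ x) :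
    Lsup r χ x ≤ ∑ s ∈ (Ioc 0 ⌊x⌋₊).filter IsSquare, Msup r χ (x / s) := by
  unfold Lsup
  refine Finset.sup'_le _ _ fun N hN => ?_
  have hN' : N ≤ ⌊x⌋₊ := Nat.lt_succ_iff.1 (mem_range.1 hN)
  refine (norm_liouvilleCharSum_le r χ N).trans ?_
  have hsub : (Ioc 0 N).filter IsSquare ⊆ (Ioc 0 ⌊x⌋₊).filter IsSquare :=
    filter_subset_filter _ (Ioc_subset_Ioc_right hN')
  calc ∑ s ∈ (Ioc 0 N).filter IsSquare, ‖moebiusCharSum r χ (N / s)‖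
      ≤ ∑ s ∈ (Ioc 0 N).filter IsSquare, Msup r χ (x / s) := by
        refine sum_le_sum fun s hs => ?_
        refine norm_moebiusCharSum_le_Msup r χ ?_
        have hs0 : 0 < s := (mem_Ioc.1 (mem_filter.1 hs).1).1
        calc (((N / s : ℕ)) : ℝ) ≤ (N : ℝ) / s := Nat.cast_div_le
          _ ≤ x / s := by
              gcongr
              exact (Nat.le_floor_iff hx).1 hN'
    _ ≤ ∑ s ∈ (Ioc 0 ⌊x⌋₊).filter IsSquare, Msup r χ (x / s) :=
        sum_le_sum_of_subset_of_nonneg hsub fun s _ _ => Msup_nonneg r χ _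

/-- `b_r(x; d) = (d/φ(d)) ∑*_{χ mod d} Λ*_r(x; χ)`, the summand of the mean value theorem in summed form.
[folklore] -/
def lmvTerm (r : ℕ) (x : ℝ) (d : ℕ) : ℝ :=
  (d : ℝ) / Nat.totient d * ∑ χ ∈ (univ : Finset (DirichletCharacter ℂ d)).filter
    DirichletCharacter.IsPrimitive, Lsup r χ x

/-- `b_r(x; d) ≥ 0`. [folklore] -/
theorem lmvTerm_nonneg (r : ℕ) (x : ℝ) (d : ℕ) : 0 ≤ lmvTerm r x d := by
  unfold lmvTerm
  exact mul_nonneg (by positivity) (Finset.sum_nonneg fun χ _ => Lsup_nonneg r χ x)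

/-- `b_r(x; d) ≤ ∑_{s ≤ x, s = □} a_r(x/s; d)` (the summed form of `Lsup_le_sum_Msup`). [folklore] -/
theorem lmvTerm_le_sum_mvTerm (r : ℕ) {x : ℝ} (hx : 0 ≤ x) (d : ℕ) :
    lmvTerm r x d ≤ ∑ s ∈ (Ioc 0 ⌊x⌋₊).filter IsSquare, mvTerm r (x / s) d := by
  unfold lmvTerm mvTerm
  rw [← mul_sum, sum_comm]
  exact mul_le_mul_of_nonneg_left (sum_le_sum fun χ _ => Lsup_le_sum_Msup r χ hx) (by positivity)

/-- The trivial bound `M*_r(y; χ) ≤ 1` at heights `y < 2` (at most one term `n = 1`). [folklore] -/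
theorem Msup_le_one_of_lt_two (r : ℕ) {d : ℕ} (χ : DirichletCharacter ℂ d) {y : ℝ} (hy : y < 2) :
    Msup r χ y ≤ 1 := by
  unfold Msup
  refine Finset.sup'_le _ _ fun N hN => ?_
  have hN' : N ≤ ⌊y⌋₊ := Nat.lt_succ_iff.1 (mem_range.1 hN)
  have hfl : ⌊y⌋₊ ≤ 1 := by
    rcases lt_or_ge y 0 with h | h
    · rw [Nat.floor_of_nonpos h.le]; exact zero_le_one
    · exact Nat.le_of_lt_succ ((Nat.floor_lt h).2 (by norm_num; linarith))
  calc ‖moebiusCharSum r χ N‖ ≤ N := norm_moebiusCharSum_le_self r χ N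
    _ ≤ 1 := by exact_mod_cast hN'.trans hfl

/-- The trivial bound `a_r(y; d) ≤ d` at heights `y < 2` (`M* ≤ 1`, at most `φ(d)` primitive characters).
[folklore] -/
theorem mvTerm_le_self_of_lt_two (r : ℕ) {y : ℝ} (hy : y < 2) {d : ℕ} (hd : 1 ≤ d) :
    mvTerm r y d ≤ d := by
  haveI : NeZero d := ⟨by omega⟩
  unfold mvTerm
  have hφ : (0 : ℝ) < Nat.totient d := by exact_mod_cast Nat.totient_pos.2 hd
  have hsum : ∑ χ ∈ (univ : Finset (DirichletCharacter ℂ d)).filter DirichletCharacter.IsPrimitive,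
      Msup r χ y ≤ Nat.totient d := by
    calc ∑ χ ∈ (univ : Finset (DirichletCharacter ℂ d)).filter DirichletCharacter.IsPrimitive, Msup r χ y
        ≤ ∑ χ ∈ (univ : Finset (DirichletCharacter ℂ d)).filter DirichletCharacter.IsPrimitive, (1 : ℝ) :=
          sum_le_sum fun χ _ => Msup_le_one_of_lt_two r χ hy
      _ = #((univ : Finset (DirichletCharacter ℂ d)).filter DirichletCharacter.IsPrimitive) := by simp
      _ ≤ #(univ : Finset (DirichletCharacter ℂ d)) := by exact_mod_cast card_filter_le _ _
      _ = Nat.totient d := by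
          rw [Finset.card_univ, ← Nat.card_eq_fintype_card,
            DirichletCharacter.card_eq_totient_of_hasEnoughRootsOfUnity ℂ d]
  calc (d : ℝ) / Nat.totient d * ∑ χ ∈ (univ : Finset (DirichletCharacter ℂ d)).filter
        DirichletCharacter.IsPrimitive, Msup r χ y
      ≤ (d : ℝ) / Nat.totient d * Nat.totient d :=
        mul_le_mul_of_nonneg_left hsum (by positivity)
    _ = d := by field_simp

/-! ### The mean value theorem for `λ` -/

/-- Elementary: `∑_{j ≤ J} 1/j ≤ 1 + log J` (harmonic numbers; `J = 0` reads `0 ≤ 1`). [folklore] -/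
theorem sum_Ioc_inv_le_one_add_log (J : ℕ) :
    ∑ j ∈ Ioc 0 J, (1 : ℝ) / j ≤ 1 + Real.log J := by
  have h := harmonic_le_one_add_log J
  have e : ∑ j ∈ Ioc 0 J, (1 : ℝ) / j = (harmonic J : ℝ) := by
    rw [harmonic_eq_sum_Icc]
    push_cast
    rw [show Ioc 0 J = Icc 1 J from rfl]
    refine sum_congr rfl fun j _ => ?_
    rw [one_div]
  rw [e]; exact h

/-- For `x ≥ 2`: `(log 2)^4 ≥ 1/5`, hence `1 ≤ 5 (log(xk))^4` for `k ≥ 1`. [folklore] -/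
theorem one_le_five_mul_log_pow_four {x : ℝ} (hx : 2 ≤ x) {k : ℕ} (hk : 1 ≤ k) :
    (1 : ℝ) ≤ 5 * Real.log (x * k) ^ 4 := by
  have hk1 : (1 : ℝ) ≤ k := by exact_mod_cast hk
  have hlog2 : (0.69 : ℝ) ≤ Real.log 2 := by
    have := Real.log_two_gt_d9; linarith
  have hle : Real.log 2 ≤ Real.log (x * k) :=
    Real.log_le_log two_pos (by nlinarith)
  have h4 : (0.69 : ℝ) ^ 4 ≤ Real.log (x * k) ^ 4 := by
    have h0 : (0 : ℝ) ≤ 0.69 := by norm_num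
    exact pow_le_pow_left₀ h0 (hlog2.trans hle) 4
  nlinarith

set_option maxHeartbeats 800000 in
/-- **Vaughan's mean value theorem for the Liouville function twisted by primitive characters, with a
coprimality condition** (summed form, maximising heights): for `r ≠ 0`, `k ≥ 1`, `x ≥ 2`,
`∑_{d ≤ k} (d/φ(d)) ∑*_{χ mod d} max_{N ≤ x} |∑_{n ≤ N, (n,r)=1} λ(n)χ(n)|`
`   ≤ 330000 τ(r) (x + (x^{5/6} k + x^{1/2} k²)(1 + log x)) log⁴(xk)` —
from the tree's Möbius theorem `BVMoebius.sum_mvTerm_le` at the heights `x/j²` over the squares `j² ≤ x`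
(`λ = 𝟙_□ ⋆ μ`): `∑_j 1/j² ≤ 2` on the `x`-term, `(x/j²)^{5/6} ≤ x^{5/6}/j`, `(x/j²)^{1/2} = x^{1/2}/j` and
`∑_{j ≤ √x} 1/j ≤ 1 + log x` on the other two, heights `x/j² < 2` trivially (`≤ k²` each, `≤ √x` of them).
[cite: Vaughan1980, Theorem 1 (the method; there for ψ)] -/
theorem sum_lmvTerm_le {r : ℕ} (hr : r ≠ 0) {k : ℕ} (hk : 1 ≤ k) {x : ℝ} (hx : 2 ≤ x) :
    ∑ d ∈ Icc 1 k, lmvTerm r x d ≤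
      330000 * (σ 0 r : ℝ) * (x + (x ^ (5 / 6 : ℝ) * k + x ^ (1 / 2 : ℝ) * (k : ℝ) ^ 2) *
        (1 + Real.log x)) * Real.log (x * k) ^ 4 := by
  have hx0 : 0 < x := by linarith
  have hx1 : 1 ≤ x := by linarith
  have hk1 : (1 : ℝ) ≤ k := by exact_mod_cast hk
  have hk0 : (0 : ℝ) < k := by linarith
  have hσ1 : (1 : ℝ) ≤ σ 0 r := by
    rw [ArithmeticFunction.sigma_zero_apply]
    exact_mod_cast Finset.card_pos.2 ⟨1, Nat.one_mem_divisors.2 hr⟩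
  set L := Real.log (x * k) with hLdef
  have hL0 : 0 ≤ L := Real.log_nonneg (by nlinarith)
  have hL4 : 0 ≤ L ^ 4 := by positivity
  have hlogx0 : 0 ≤ Real.log x := Real.log_nonneg hx1
  -- Step 1: `∑_d b_r(x; d) ≤ ∑_{s ≤ x, s = □} ∑_d a_r(x/s; d)`
  have h1 : ∑ d ∈ Icc 1 k, lmvTerm r x d ≤
      ∑ s ∈ (Ioc 0 ⌊x⌋₊).filter IsSquare, ∑ d ∈ Icc 1 k, mvTerm r (x / s) d := by
    rw [sum_comm]
    exact sum_le_sum fun d _ => lmvTerm_le_sum_mvTerm r hx0.le d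
  -- Step 2: bound each square `s` : heights `x/s ≥ 2` by the Möbius theorem, `x/s < 2` trivially
  set B : ℕ → ℝ := fun s =>
    110000 * (σ 0 r : ℝ) * (x / s + x ^ (5 / 6 : ℝ) * k / Real.sqrt s +
      x ^ (1 / 2 : ℝ) * (k : ℝ) ^ 2 / Real.sqrt s) * L ^ 4 + (k : ℝ) ^ 2 with hBdef
  have h2 : ∀ s ∈ (Ioc 0 ⌊x⌋₊).filter IsSquare, ∑ d ∈ Icc 1 k, mvTerm r (x / s) d ≤ B s := by
    intro s hs
    rw [mem_filter, mem_Ioc] at hs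
    obtain ⟨⟨hs0, hsx⟩, -⟩ := hs
    have hs0' : (0 : ℝ) < s := by exact_mod_cast hs0
    have hs1 : (1 : ℝ) ≤ s := by exact_mod_cast hs0
    have hsx' : (s : ℝ) ≤ x := (Nat.cast_le.2 hsx).trans (Nat.floor_le hx0.le)
    have hsq0 : 0 < Real.sqrt s := Real.sqrt_pos.2 hs0'
    have hsq1 : 1 ≤ Real.sqrt s := by rw [← Real.sqrt_one]; exact Real.sqrt_le_sqrt hs1
    have hk2 : (0 : ℝ) ≤ (k : ℝ) ^ 2 := by positivity
    have hmain : 0 ≤ 110000 * (σ 0 r : ℝ) * (x / s + x ^ (5 / 6 : ℝ) * k / Real.sqrt s +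
        x ^ (1 / 2 : ℝ) * (k : ℝ) ^ 2 / Real.sqrt s) * L ^ 4 := by positivity
    rcases lt_or_ge (x / s) 2 with hlt | hge
    · -- trivial heights
      calc ∑ d ∈ Icc 1 k, mvTerm r (x / s) d ≤ ∑ d ∈ Icc 1 k, (d : ℝ) :=
            sum_le_sum fun d hd => mvTerm_le_self_of_lt_two r hlt (mem_Icc.1 hd).1
        _ ≤ ∑ d ∈ Icc 1 k, (k : ℝ) := sum_le_sum fun d hd => by exact_mod_cast (mem_Icc.1 hd).2
        _ = (k : ℝ) ^ 2 := by simp [sq]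
        _ ≤ B s := by rw [hBdef]; linarith
    · -- the Möbius mean value theorem at height `x/s`
      have hmv := sum_mvTerm_le hr hk hge
      have hlog : Real.log (x / s * k) ^ 4 ≤ L ^ 4 := by
        have hpos : 0 < x / s * k := by positivity
        have hle : x / s * k ≤ x * k := by
          rw [div_mul_eq_mul_div]
          exact div_le_self (by positivity) hs1
        have hl0 : 0 ≤ Real.log (x / s * k) := Real.log_nonneg (by nlinarith)
        exact pow_le_pow_left₀ hl0 (Real.log_le_log hpos hle) 4
      have hpow56 : (x / s) ^ (5 / 6 : ℝ) ≤ x ^ (5 / 6 : ℝ) / Real.sqrt s := by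
        -- `(x/s)^{5/6} = x^{5/6} / s^{5/6} ≤ x^{5/6} / s^{1/2}`
        rw [Real.div_rpow hx0.le hs0'.le, Real.sqrt_eq_rpow]
        have hden : (s : ℝ) ^ (1 / 2 : ℝ) ≤ (s : ℝ) ^ (5 / 6 : ℝ) :=
          Real.rpow_le_rpow_of_exponent_le hs1 (by norm_num)
        have hpos : 0 < (s : ℝ) ^ (1 / 2 : ℝ) := Real.rpow_pos_of_pos hs0' _
        exact div_le_div_of_nonneg_left (by positivity) hpos hden
      have hpow12 : (x / s) ^ (1 / 2 : ℝ) = x ^ (1 / 2 : ℝ) / Real.sqrt s := by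
        rw [Real.div_rpow hx0.le hs0'.le, Real.sqrt_eq_rpow]
      have hbr : x / s + (x / s) ^ (5 / 6 : ℝ) * k + (x / s) ^ (1 / 2 : ℝ) * (k : ℝ) ^ 2 ≤
          x / s + x ^ (5 / 6 : ℝ) * k / Real.sqrt s + x ^ (1 / 2 : ℝ) * (k : ℝ) ^ 2 / Real.sqrt s := by
        rw [hpow12]
        have := mul_le_mul_of_nonneg_right hpow56 hk0.le
        have e1 : x ^ (5 / 6 : ℝ) / Real.sqrt s * k = x ^ (5 / 6 : ℝ) * k / Real.sqrt s := by ring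
        have e2 : x ^ (1 / 2 : ℝ) / Real.sqrt s * (k : ℝ) ^ 2 =
            x ^ (1 / 2 : ℝ) * (k : ℝ) ^ 2 / Real.sqrt s := by ring
        linarith
      have hbr0 : 0 ≤ x / s + x ^ (5 / 6 : ℝ) * k / Real.sqrt s +
          x ^ (1 / 2 : ℝ) * (k : ℝ) ^ 2 / Real.sqrt s := by positivity
      have hl0 : 0 ≤ Real.log (x / s * k) ^ 4 := by positivity
      have hc0 : 0 ≤ 110000 * (σ 0 r : ℝ) := by positivity
      calc ∑ d ∈ Icc 1 k, mvTerm r (x / s) d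
          ≤ 110000 * (σ 0 r : ℝ) * (x / s + (x / s) ^ (5 / 6 : ℝ) * k +
              (x / s) ^ (1 / 2 : ℝ) * (k : ℝ) ^ 2) * Real.log (x / s * k) ^ 4 := hmv
        _ ≤ 110000 * (σ 0 r : ℝ) * (x / s + x ^ (5 / 6 : ℝ) * k / Real.sqrt s +
              x ^ (1 / 2 : ℝ) * (k : ℝ) ^ 2 / Real.sqrt s) * Real.log (x / s * k) ^ 4 :=
            mul_le_mul_of_nonneg_right (mul_le_mul_of_nonneg_left hbr hc0) hl0
        _ ≤ 110000 * (σ 0 r : ℝ) * (x / s + x ^ (5 / 6 : ℝ) * k / Real.sqrt s +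
              x ^ (1 / 2 : ℝ) * (k : ℝ) ^ 2 / Real.sqrt s) * L ^ 4 :=
            mul_le_mul_of_nonneg_left hlog (mul_nonneg hc0 hbr0)
        _ ≤ B s := by rw [hBdef]; linarith
  -- Step 3: sum the bounds over the squares `s = j²`, `j ≤ √x`
  have h3 : ∑ s ∈ (Ioc 0 ⌊x⌋₊).filter IsSquare, B s ≤
      110000 * (σ 0 r : ℝ) * (2 * x + (x ^ (5 / 6 : ℝ) * k + x ^ (1 / 2 : ℝ) * (k : ℝ) ^ 2) *
        (1 + Real.log x)) * L ^ 4 + Real.sqrt x * (k : ℝ) ^ 2 := by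
    rw [Literature.NumberTheory.LFunctions.SiegelWalfiszLiouville.filter_isSquare_Ioc_eq_image,
      sum_image fun j₁ _ j₂ _ h => Nat.mul_self_inj.1 h]
    set J := Nat.sqrt ⌊x⌋₊ with hJdef
    have hJx : (J : ℝ) ≤ Real.sqrt x := by
      rw [hJdef, Real.le_sqrt (Nat.cast_nonneg _) hx0.le]
      calc ((Nat.sqrt ⌊x⌋₊ : ℕ) : ℝ) ^ 2 = ((Nat.sqrt ⌊x⌋₊ * Nat.sqrt ⌊x⌋₊ : ℕ) : ℝ) := by push_cast; ring
        _ ≤ (⌊x⌋₊ : ℝ) := by exact_mod_cast Nat.sqrt_le ⌊x⌋₊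
        _ ≤ x := Nat.floor_le hx0.le
    have hJ1 : 1 ≤ J := by
      rw [hJdef, Nat.le_sqrt]
      exact Nat.le_floor (by norm_num; linarith)
    -- the three elementary sums
    have hsum2 : ∑ j ∈ Ioc 0 J, x / ((j * j : ℕ) : ℝ) ≤ 2 * x := by
      have := Literature.NumberTheory.LFunctions.SiegelWalfiszLiouville.sum_Ioc_inv_sq_le_two J
      calc ∑ j ∈ Ioc 0 J, x / ((j * j : ℕ) : ℝ) = x * ∑ j ∈ Ioc 0 J, (1 : ℝ) / (j : ℝ) ^ 2 := by
            rw [mul_sum]; refine sum_congr rfl fun j _ => ?_; push_cast; ring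
        _ ≤ x * 2 := mul_le_mul_of_nonneg_left this hx0.le
        _ = 2 * x := by ring
    have hsqj : ∀ j ∈ Ioc 0 J, Real.sqrt ((j * j : ℕ) : ℝ) = j := by
      intro j _
      push_cast
      exact Real.sqrt_mul_self (Nat.cast_nonneg j)
    have hharm : ∑ j ∈ Ioc 0 J, (1 : ℝ) / j ≤ 1 + Real.log x := by
      refine (sum_Ioc_inv_le_one_add_log J).trans ?_
      have hJ0 : (0 : ℝ) < J := by exact_mod_cast hJ1
      have : Real.log J ≤ Real.log x := by
        refine Real.log_le_log hJ0 (hJx.trans ?_)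
        rw [Real.sqrt_le_left hx0.le]
        nlinarith
      linarith
    have hsumA : ∑ j ∈ Ioc 0 J, x ^ (5 / 6 : ℝ) * k / Real.sqrt ((j * j : ℕ) : ℝ) ≤
        x ^ (5 / 6 : ℝ) * k * (1 + Real.log x) := by
      calc ∑ j ∈ Ioc 0 J, x ^ (5 / 6 : ℝ) * k / Real.sqrt ((j * j : ℕ) : ℝ)
          = x ^ (5 / 6 : ℝ) * k * ∑ j ∈ Ioc 0 J, (1 : ℝ) / j := by
            rw [mul_sum]; refine sum_congr rfl fun j hj => ?_; rw [hsqj j hj]; ring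
        _ ≤ x ^ (5 / 6 : ℝ) * k * (1 + Real.log x) :=
            mul_le_mul_of_nonneg_left hharm (by positivity)
    have hsumB : ∑ j ∈ Ioc 0 J, x ^ (1 / 2 : ℝ) * (k : ℝ) ^ 2 / Real.sqrt ((j * j : ℕ) : ℝ) ≤
        x ^ (1 / 2 : ℝ) * (k : ℝ) ^ 2 * (1 + Real.log x) := by
      calc ∑ j ∈ Ioc 0 J, x ^ (1 / 2 : ℝ) * (k : ℝ) ^ 2 / Real.sqrt ((j * j : ℕ) : ℝ)
          = x ^ (1 / 2 : ℝ) * (k : ℝ) ^ 2 * ∑ j ∈ Ioc 0 J, (1 : ℝ) / j := by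
            rw [mul_sum]; refine sum_congr rfl fun j hj => ?_; rw [hsqj j hj]; ring
        _ ≤ x ^ (1 / 2 : ℝ) * (k : ℝ) ^ 2 * (1 + Real.log x) :=
            mul_le_mul_of_nonneg_left hharm (by positivity)
    have hsumC : ∑ _j ∈ Ioc 0 J, (k : ℝ) ^ 2 ≤ Real.sqrt x * (k : ℝ) ^ 2 := by
      rw [sum_const, Nat.card_Ioc, Nat.sub_zero, nsmul_eq_mul]
      exact mul_le_mul_of_nonneg_right hJx (by positivity)
    -- assemble
    have hexp : ∑ j ∈ Ioc 0 J, B (j * j) =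
        110000 * (σ 0 r : ℝ) * L ^ 4 * (∑ j ∈ Ioc 0 J, x / ((j * j : ℕ) : ℝ) +
          ∑ j ∈ Ioc 0 J, x ^ (5 / 6 : ℝ) * k / Real.sqrt ((j * j : ℕ) : ℝ) +
          ∑ j ∈ Ioc 0 J, x ^ (1 / 2 : ℝ) * (k : ℝ) ^ 2 / Real.sqrt ((j * j : ℕ) : ℝ)) +
          ∑ _j ∈ Ioc 0 J, (k : ℝ) ^ 2 := by
      rw [hBdef]
      simp only []
      rw [← sum_add_distrib, ← sum_add_distrib, mul_sum, ← sum_add_distrib]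
      refine sum_congr rfl fun j _ => ?_
      ring
    rw [hexp]
    have hcoef : 0 ≤ 110000 * (σ 0 r : ℝ) * L ^ 4 := by positivity
    nlinarith [mul_le_mul_of_nonneg_left (add_le_add (add_le_add hsum2 hsumA) hsumB) hcoef, hsumC]
  -- Step 4: constants
  have hsqrt : Real.sqrt x * (k : ℝ) ^ 2 ≤
      110000 * (σ 0 r : ℝ) * (x ^ (1 / 2 : ℝ) * (k : ℝ) ^ 2 * (1 + Real.log x)) * L ^ 4 := by
    have h5 := one_le_five_mul_log_pow_four hx hk
    rw [Real.sqrt_eq_rpow]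
    have hb : 0 ≤ x ^ (1 / 2 : ℝ) * (k : ℝ) ^ 2 := by positivity
    have hlog1 : (1 : ℝ) ≤ 1 + Real.log x := by linarith
    calc x ^ (1 / 2 : ℝ) * (k : ℝ) ^ 2 = x ^ (1 / 2 : ℝ) * (k : ℝ) ^ 2 * 1 * 1 * 1 := by ring
      _ ≤ x ^ (1 / 2 : ℝ) * (k : ℝ) ^ 2 * (1 + Real.log x) * (σ 0 r : ℝ) * (5 * L ^ 4) := by
          gcongr
      _ ≤ 110000 * (σ 0 r : ℝ) * (x ^ (1 / 2 : ℝ) * (k : ℝ) ^ 2 * (1 + Real.log x)) * L ^ 4 := by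
          nlinarith [mul_nonneg (mul_nonneg hb (by linarith : (0:ℝ) ≤ 1 + Real.log x))
            (mul_nonneg (by linarith : (0:ℝ) ≤ σ 0 r) hL4)]
  have hfin : 110000 * (σ 0 r : ℝ) * (2 * x + (x ^ (5 / 6 : ℝ) * k + x ^ (1 / 2 : ℝ) * (k : ℝ) ^ 2) *
        (1 + Real.log x)) * L ^ 4 + Real.sqrt x * (k : ℝ) ^ 2 ≤
      330000 * (σ 0 r : ℝ) * (x + (x ^ (5 / 6 : ℝ) * k + x ^ (1 / 2 : ℝ) * (k : ℝ) ^ 2) *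
        (1 + Real.log x)) * L ^ 4 := by
    have hA : 0 ≤ (σ 0 r : ℝ) * x * L ^ 4 := by positivity
    have hB : 0 ≤ (σ 0 r : ℝ) * (x ^ (5 / 6 : ℝ) * k * (1 + Real.log x)) * L ^ 4 := by positivity
    have hC : 0 ≤ (σ 0 r : ℝ) * (x ^ (1 / 2 : ℝ) * (k : ℝ) ^ 2 * (1 + Real.log x)) * L ^ 4 := by
      positivity
    nlinarith [hsqrt]
  exact h1.trans ((sum_le_sum h2).trans (h3.trans hfin))

end LiouvilleMV

end Literature.NumberTheory.Sieve

end
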